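import Literature.Algebra.Homology.DiscreteRepStandardResolution
import Mathlib.RingTheory.Finiteness.Defs
import HarnessLib

/-!
# The internal `Hom(N, P)` of `C_Γ` for `N` finitely generated: discreteness, the curry isomorphism
# `Hom_{C_Γ}(N, P) ≃+ Hom_{C_Γ}(k, Hom(N, P))`, and `Hom(N, CoInd V) ≅ CoInd(Hom_k(N, V))`

Topic `Algebra/Homology`; namespace `Literature.Algebra.Homology.DiscreteRep`.  Definitions with bodies
and theorems; no named fact, no `sorry`, no notation; one `Functor.Additive` instance for the new
functor.  Sequel of `DiscreteRepCategory` (the abelian category `C_Γ = DiscreteRepCat k Γ` of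
`k`-linear representations of a topological group `Γ` with open stabilisers — Harari's `C_G`),
`DiscreteRepInvariants` (`triv`), `DiscreteRepCoinduced` (`coind k Γ V = LocallyConstant Γ V`,
`ext_triv_eq_zero_of_iso_coind`), `ExtOfAcyclicResolution` (`extComplex X I = Ext⁰(X, I•)`) and
`DiscreteRepStandardResolution` (bookkeeping lemma `addEquiv₀_comp_mk₀`).
Written for Route A of the Poitou–Tate programme of crux `stmt-BirchSwinnertonDyer-19295`
(cell `bsd-schneider-ideate`, seat door-c4 gen 14), item (A2) of FINDING-door-c6-g11 §2 /
(I-d′) of FINDING-door-c4-g13 §3: the identification **`Extʳ_{C_Γ}(N, P) = Hʳ(Γ, Hom(N, P))`**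
for `N` of finite type (Harari, *Galois Cohomology and Class Field Theory*, Prop. 16.16 (b);
Milne, *Arithmetic Duality Theorems*, I §0 Example 0.8), which in print is read off the spectral
sequence `Hʳ(G, Extˢ(N, P)) ⇒ Ext^{r+s}_G(N, P)` (Harari Thm. 16.14 / Example 16.15 (b)).  The tree
proves it WITHOUT spectral sequences (sequel file `DiscreteRepExtInternalHom`): `Hom_k(N, ·)` applied
to Mathlib's standard resolution of `P` is an exact, `Ext(k, –)`-acyclic resolution of `Hom(N, P)`.
This file supplies the three ingredients that do not involve the resolution:

* §1 **`Hom_k(N, P)` with the conjugation action `(g·F) = ρ_P(g) ∘ F ∘ ρ_N(g⁻¹)` (Mathlib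
  `Rep.ihom`) has open stabilisers when `N` is finitely generated over `k`** (`isDiscrete_ihom`:
  the stabiliser of `F` contains the finite intersection of the stabilisers of the generators `sᵢ`
  and of their images `F sᵢ`) — Harari's remark that for `M` of finite type there is no need to
  distinguish `Hom` from the discrete `𝓗om` (Def. 16.10, Rem. 16.13); the object `ihomObj N P` and
  the functor `ihomFunctor N : C_Γ ⥤ C_Γ` (post-composition), additive and mono-preserving.
* §2 **Curry**: `curryHomAddEquiv : (N ⟶ P) ≃+ (triv k ⟶ ihomObj N P)` (`f ↦ (c ↦ c • f)`,
  inverse `φ ↦ φ(1)`: the `Γ`-invariant linear maps are the equivariant ones), natural in `P`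
  (`curryHom_comp`); on `Ext⁰`: `curryExt₀`, `curryExt₀_comp_mk₀`; and for every cochain complex
  `I` of `C_Γ` the isomorphism of complexes of abelian groups
  **`extComplexCurryIso N I : Ext⁰(N, I•) ≅ Ext⁰(triv k, Hom(N, I•))`**.
* §3 **`Hom_k(N, CoInd V) ≅ CoInd(Hom_k(N, V))` in `C_Γ`** (`ihomCoindIso`; `Γ` compact):
  `Φ ↦ (a ↦ (x ↦ Φ(x)(ρ_N(x⁻¹) a)))` with inverse `F ↦ (x ↦ (a ↦ F(ρ_N(x) a)(x)))`, hence
  **`Ext^{q+1}_{C_Γ}(triv k, Hom(N, M)) = 0` whenever `M ≅ CoInd V`**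
  (`ext_triv_ihomObj_eq_zero_of_iso_coind`) — the acyclicity half of the resolution argument.

HONEST FRAMING: homological algebra only; no arithmetic statement is proved here.

## References
* D. Harari, *Galois Cohomology and Class Field Theory*, Universitext, Springer (2020), §16.2:
  Definition 16.10 (p. 268), Remark 16.13 (p. 269), Theorem 16.14 (p. 269), Example 16.15 (b) and
  Proposition 16.16 (p. 271). [Harari2020]
* J. S. Milne, *Arithmetic Duality Theorems*, 2nd ed. (2006), I §0, Example 0.8 and Remark 0.11.
  [MilneADT2006]
* J.-P. Serre, *Galois Cohomology*, Springer (1997), I §2.5 (induced modules). [SerreGaloisCohomology1997]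
-/

noncomputable section

universe u

namespace Literature.Algebra.Homology

namespace DiscreteRep

open CategoryTheory CategoryTheory.Limits CategoryTheory.Abelian Filter
open scoped _root_.Topology

variable {k Γ : Type u} [CommRing k] [Group Γ] [TopologicalSpace Γ] [IsTopologicalGroup Γ]

/-! ## §1 `Hom_k(N, P)` is a discrete representation for `N` finitely generated -/

section IhomObj

variable (N P : DiscreteRepCat k Γ) [Module.Finite k N.obj.V]

/-- **For `N` finitely generated over `k`, every stabiliser of the conjugation action on
`Hom_k(N, P)` is open**: it contains `⋂ᵢ (stab_N(sᵢ) ∩ stab_P(F sᵢ))` for a finite generating family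
`(sᵢ)` of `N` (a linear map is determined by its values on generators).
[cite: Harari2020, §16.2, Definition 16.10 and Remark 16.13 (pp. 268–269)] -/
theorem isDiscrete_ihom : IsDiscrete ((Rep.ihom N.obj).obj P.obj) :=
    fun (F : N.obj.V →ₗ[k] P.obj.V) => by
  obtain ⟨n, s, hs⟩ := Module.Finite.exists_fin (R := k) (M := N.obj.V)
  refine Subgroup.isOpen_mono
    (H₁ := ⨅ i, stabilizer N.obj (s i) ⊓ stabilizer P.obj (F (s i))) ?_ ?_
  · intro g hg
    rw [mem_stabilizer_iff]
    change P.obj.ρ g ∘ₗ F ∘ₗ N.obj.ρ g⁻¹ = F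
    refine LinearMap.ext_on_range hs fun i => ?_
    have hi := (Subgroup.mem_iInf.1 hg) i
    have hN : N.obj.ρ g⁻¹ (s i) = s i :=
      (mem_stabilizer_iff _ _ _).1 (Subgroup.inv_mem _ (Subgroup.mem_inf.1 hi).1)
    have hP : P.obj.ρ g (F (s i)) = F (s i) := (mem_stabilizer_iff _ _ _).1 (Subgroup.mem_inf.1 hi).2
    simp only [LinearMap.coe_comp, Function.comp_apply, hN, hP]
  · rw [Subgroup.coe_iInf]
    exact isOpen_iInter_of_finite fun i => by
      rw [Subgroup.coe_inf]
      exact (N.property (s i)).inter (P.property (F (s i)))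

/-- **The internal `Hom(N, P)` of `C_Γ`** for `N` finitely generated: the linear maps `N → P` with
the conjugation action `(g·F) = ρ_P(g) ∘ F ∘ ρ_N(g⁻¹)` (Mathlib `Representation.linHom`, the object
`(Rep.ihom N).obj P` of `Rep k Γ`), which has open stabilisers.  (An `abbrev` over `Rep.of`, so that
the carrier is reducibly the type of linear maps.)
[cite: Harari2020, §16.2, Definition 16.10 and Remark 16.13 (pp. 268–269)] -/
abbrev ihomObj : DiscreteRepCat k Γ :=
  mk (Rep.of (Representation.linHom N.obj.ρ P.obj.ρ)) (isDiscrete_ihom N P)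

/-- The underlying representation of `ihomObj N P` is Mathlib's internal Hom `(Rep.ihom N).obj P`.
[cite: Harari2020, §16.2, Definition 16.10 (p. 268)] -/
theorem ihomObj_obj : (ihomObj N P).obj = (Rep.ihom N.obj).obj P.obj := rfl

/-- The action on `ihomObj N P`: conjugation. [cite: Harari2020, §16.2, Definition 16.10 (p. 268)] -/
@[simp]
theorem ihomObj_ρ_apply (g : Γ) (F : N.obj.V →ₗ[k] P.obj.V) :
    (ihomObj N P).obj.ρ g F = P.obj.ρ g ∘ₗ F ∘ₗ N.obj.ρ g⁻¹ := rfl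

/-- An EQUIVARIANT linear map is fixed by the conjugation action.
[cite: Harari2020, §16.2, Remark 16.13 (p. 269)] -/
theorem ihomObj_ρ_apply_hom (g : Γ) (f : N ⟶ P) :
    (ihomObj N P).obj.ρ g f.hom.hom.toLinearMap = f.hom.hom.toLinearMap := by
  rw [ihomObj_ρ_apply]
  refine LinearMap.ext fun x => ?_
  simp only [LinearMap.coe_comp, Function.comp_apply, Representation.IntertwiningMap.coe_toLinearMap]
  rw [Rep.hom_comm_apply, ← Module.End.mul_apply, ← map_mul, mul_inv_cancel, map_one,
    Module.End.one_apply]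

variable {P} in
/-- Conversely a linear map fixed by the conjugation action is equivariant.
[cite: Harari2020, §16.2, Remark 16.13 (p. 269)] -/
theorem comm_of_forall_ρ_apply_eq (F : N.obj.V →ₗ[k] P.obj.V)
    (hF : ∀ g : Γ, (ihomObj N P).obj.ρ g F = F) (g : Γ) (x : N.obj.V) :
    F (N.obj.ρ g x) = P.obj.ρ g (F x) := by
  have h := LinearMap.congr_fun (hF g) (N.obj.ρ g x)
  rw [ihomObj_ρ_apply, LinearMap.comp_apply, LinearMap.comp_apply, ← Module.End.mul_apply, ← map_mul,
    inv_mul_cancel, map_one, Module.End.one_apply] at h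
  exact h.symm

/-- **The internal-Hom functor `P ↦ Hom(N, P)` on `C_Γ`** (post-composition on morphisms; on the
underlying representations it is Mathlib's `Rep.ihom N`, see `ι_ihomFunctor_map`).
[cite: Harari2020, §16.2, Definition 16.11 (p. 268)] -/
abbrev ihomFunctor : DiscreteRepCat k Γ ⥤ DiscreteRepCat k Γ where
  obj P := ihomObj N P
  map {P Q} f := ObjectProperty.homMk (Rep.ofHom
    ⟨LinearMap.llcomp k N.obj.V P.obj.V Q.obj.V f.hom.hom.toLinearMap, fun g =>
      LinearMap.ext fun F => LinearMap.ext fun x => by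
        change f.hom.hom ((P.obj.ρ g ∘ₗ F ∘ₗ N.obj.ρ g⁻¹) x) =
          (Q.obj.ρ g ∘ₗ (f.hom.hom.toLinearMap ∘ₗ F) ∘ₗ N.obj.ρ g⁻¹) x
        simp only [LinearMap.coe_comp, Function.comp_apply, Representation.IntertwiningMap.coe_toLinearMap]
        rw [Rep.hom_comm_apply]⟩)
  map_id P := ObjectProperty.hom_ext _ (Rep.hom_ext (DFunLike.ext _ _ fun _ => rfl))
  map_comp f g := ObjectProperty.hom_ext _ (Rep.hom_ext (DFunLike.ext _ _ fun _ => rfl))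

/-- On objects: `(ihomFunctor N).obj P = ihomObj N P`. [cite: Harari2020, §16.2, Definition 16.11 (p. 268)] -/
theorem ihomFunctor_obj : (ihomFunctor N).obj P = ihomObj N P := rfl

variable {P} in
/-- On the underlying representations `ihomFunctor N` is Mathlib's `Rep.ihom N`:
`ι (Hom(N, f)) = (Rep.ihom N).map (ι f)`. [cite: Harari2020, §16.2, Definition 16.11 (p. 268)] -/
theorem ι_ihomFunctor_map {Q : DiscreteRepCat k Γ} (f : P ⟶ Q) :
    (ι k Γ).map ((ihomFunctor N).map f) = (Rep.ihom N.obj).map ((ι k Γ).map f) := rfl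

variable {P} in
/-- On morphisms: post-composition. [cite: Harari2020, §16.2, Definition 16.11 (p. 268)] -/
@[simp]
theorem ihomFunctor_map_apply {Q : DiscreteRepCat k Γ} (f : P ⟶ Q) (F : N.obj.V →ₗ[k] P.obj.V) :
    ((ihomFunctor N).map f).hom.hom F = f.hom.hom.toLinearMap ∘ₗ F := rfl

/-- `ihomFunctor N` is additive. [cite: Harari2020, §16.2, Definition 16.11 (p. 268)] -/
instance ihomFunctor_additive : (ihomFunctor N).Additive where
  map_add {P Q f g} := by
    refine ObjectProperty.hom_ext _ (Rep.hom_ext (DFunLike.ext _ _ fun F => LinearMap.ext fun x => ?_))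
    rfl

variable {P} in
/-- `ihomFunctor N` preserves monomorphisms (post-composition with an injective map is injective).
[cite: Harari2020, §16.2, Definition 16.11 (p. 268)] -/
theorem mono_ihomFunctor_map {Q : DiscreteRepCat k Γ} (f : P ⟶ Q) [Mono f] :
    Mono ((ihomFunctor N).map f) := by
  apply (ι k Γ).mono_of_mono_map
  rw [Rep.mono_iff_injective]
  have hf : Function.Injective f.hom.hom := (Rep.mono_iff_injective ((ι k Γ).map f)).1 inferInstance
  intro F G hFG
  refine LinearMap.ext fun x => hf ?_
  have h := LinearMap.congr_fun hFG x
  exact h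

end IhomObj

/-! ## §2 Curry: `Hom_{C_Γ}(N, P) ≃+ Hom_{C_Γ}(triv k, Hom(N, P))`, and on `Ext⁰`-complexes -/

section Curry

variable (N : DiscreteRepCat k Γ) [Module.Finite k N.obj.V] (P : DiscreteRepCat k Γ)

variable {P} in
/-- **Currying an equivariant map**: `f ↦ (c ↦ c • f)`, a morphism `triv k ⟶ Hom(N, P)` (the
equivariant `f` is a `Γ`-invariant vector of `Hom(N, P)`).
[cite: Harari2020, §16.2, Theorem 16.14, proof, (16.2) (p. 269)] -/
def curryHom (f : N ⟶ P) : triv (Γ := Γ) k ⟶ ihomObj N P :=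
  ObjectProperty.homMk (Rep.ofHom
    ⟨LinearMap.toSpanSingleton k (N.obj.V →ₗ[k] P.obj.V) f.hom.hom.toLinearMap, fun g =>
      LinearMap.ext fun c => by
        change (Representation.trivial k Γ k g c) • f.hom.hom.toLinearMap =
          (ihomObj N P).obj.ρ g (c • f.hom.hom.toLinearMap)
        rw [Representation.trivial_apply, LinearMap.map_smul, ihomObj_ρ_apply_hom]⟩)

variable {P} in
/-- Formula: `(curryHom N f) c = c • f`. [cite: Harari2020, §16.2, Theorem 16.14, proof, (16.2) (p. 269)] -/
@[simp]
theorem curryHom_apply (f : N ⟶ P) (c : k) :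
    (curryHom N f).hom.hom c = c • f.hom.hom.toLinearMap := rfl

variable {P} in
/-- **Uncurrying**: `φ ↦ φ(1)`, an equivariant map `N ⟶ P` (a `Γ`-invariant linear map is
equivariant). [cite: Harari2020, §16.2, Theorem 16.14, proof, (16.2) (p. 269)] -/
def uncurryHom (φ : triv (Γ := Γ) k ⟶ ihomObj N P) : N ⟶ P :=
  ObjectProperty.homMk (Rep.ofHom
    ⟨(φ.hom.hom (1 : k) : N.obj.V →ₗ[k] P.obj.V), fun g => LinearMap.ext fun x => by
      change (φ.hom.hom (1 : k) : N.obj.V →ₗ[k] P.obj.V) (N.obj.ρ g x) =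
        P.obj.ρ g ((φ.hom.hom (1 : k) : N.obj.V →ₗ[k] P.obj.V) x)
      refine comm_of_forall_ρ_apply_eq N _ (fun h => ?_) g x
      rw [← Rep.hom_comm_apply φ.hom h (1 : k), Rep.trivial_ρ_apply]⟩)

variable {P} in
/-- Formula: `(uncurryHom N φ) x = φ(1)(x)`. [cite: Harari2020, §16.2, Theorem 16.14, proof, (16.2) (p. 269)] -/
@[simp]
theorem uncurryHom_apply (φ : triv (Γ := Γ) k ⟶ ihomObj N P) (x : N.obj.V) :
    (uncurryHom N φ).hom.hom x = (φ.hom.hom (1 : k) : N.obj.V →ₗ[k] P.obj.V) x := rfl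

/-- **`Hom_{C_Γ}(N, P) ≃+ Hom_{C_Γ}(triv k, Hom(N, P))`** (curry / uncurry).
[cite: Harari2020, §16.2, Theorem 16.14, proof, (16.2) (p. 269)] -/
def curryHomAddEquiv : (N ⟶ P) ≃+ (triv (Γ := Γ) k ⟶ ihomObj N P) where
  toFun := curryHom N
  invFun := uncurryHom N
  left_inv f := ObjectProperty.hom_ext _ (Rep.hom_ext (DFunLike.ext _ _ fun x => by
    rw [uncurryHom_apply, curryHom_apply, one_smul]
    rfl))
  right_inv φ := ObjectProperty.hom_ext _ (Rep.hom_ext (DFunLike.ext _ _ fun c => by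
    rw [curryHom_apply]
    change c • φ.hom.hom (1 : k) = φ.hom.hom c
    rw [← map_smul, smul_eq_mul, mul_one]))
  map_add' f g := ObjectProperty.hom_ext _ (Rep.hom_ext (DFunLike.ext _ _ fun c =>
    LinearMap.ext fun x => by
      change c • (f.hom.hom x + g.hom.hom x) = c • f.hom.hom x + c • g.hom.hom x
      rw [smul_add]))

/-- `curryHomAddEquiv` is `curryHom`. [cite: Harari2020, §16.2, Theorem 16.14, proof, (16.2) (p. 269)] -/
@[simp]
theorem curryHomAddEquiv_apply (f : N ⟶ P) : curryHomAddEquiv N P f = curryHom N f := rfl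

/-- `curryHomAddEquiv.symm` is `uncurryHom`. [cite: Harari2020, §16.2, Theorem 16.14, proof, (16.2) (p. 269)] -/
@[simp]
theorem curryHomAddEquiv_symm_apply (φ : triv (Γ := Γ) k ⟶ ihomObj N P) :
    (curryHomAddEquiv N P).symm φ = uncurryHom N φ := rfl

variable {P} in
/-- **Naturality of curry in `P`**: `curry (f ≫ h) = curry f ≫ Hom(N, h)`.
[cite: Harari2020, §16.2, Theorem 16.14, proof, (16.2) (p. 269)] -/
theorem curryHom_comp {Q : DiscreteRepCat k Γ} (f : N ⟶ P) (h : P ⟶ Q) :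
    curryHom N (f ≫ h) = curryHom N f ≫ (ihomFunctor N).map h := by
  refine ObjectProperty.hom_ext _ (Rep.hom_ext (DFunLike.ext _ _ fun c => LinearMap.ext fun x => ?_))
  change (c • (f ≫ h).hom.hom.toLinearMap) x =
    (((ihomFunctor N).map h).hom.hom (c • f.hom.hom.toLinearMap) : N.obj.V →ₗ[k] Q.obj.V) x
  rw [ihomFunctor_map_apply, LinearMap.smul_apply, LinearMap.comp_apply, LinearMap.smul_apply,
    map_smul]
  rfl

/-- **Curry on `Ext⁰`**: `Ext⁰(N, P) ≃+ Ext⁰(triv k, Hom(N, P))` (`Ext⁰ = Hom` on both sides).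
[cite: Harari2020, §16.2, Theorem 16.14, proof, (16.2) (p. 269)] -/
def curryExt₀ : Ext N P 0 ≃+ Ext (triv (Γ := Γ) k) (ihomObj N P) 0 :=
  Ext.addEquiv₀.trans <| (curryHomAddEquiv N P).trans Ext.addEquiv₀.symm

variable {P} in
/-- **Naturality of `curryExt₀` in `P`**: `curry (x ∘ h) = curry x ∘ Hom(N, h)` on `Ext⁰`.
[cite: Harari2020, §16.2, Theorem 16.14, proof, (16.2) (p. 269)] -/
theorem curryExt₀_comp_mk₀ {Q : DiscreteRepCat k Γ} (x : Ext N P 0) (h : P ⟶ Q) :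
    curryExt₀ N Q (x.comp (Ext.mk₀ h) (add_zero 0)) =
      (curryExt₀ N P x).comp (Ext.mk₀ ((ihomFunctor N).map h)) (add_zero 0) := by
  apply Ext.addEquiv₀.injective
  rw [addEquiv₀_comp_mk₀]
  simp only [curryExt₀, AddEquiv.trans_apply, AddEquiv.apply_symm_apply, curryHomAddEquiv_apply]
  rw [addEquiv₀_comp_mk₀, curryHom_comp]

/-- **The curry isomorphism of `Ext⁰`-complexes**: for every cochain complex `I` of `C_Γ`,
`Ext⁰(N, I•) ≅ Ext⁰(triv k, Hom(N, I•))` as cochain complexes of abelian groups.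
[cite: Harari2020, §16.2, Theorem 16.14, proof, (16.2) (p. 269)] -/
def extComplexCurryIso (I : CochainComplex (DiscreteRepCat k Γ) ℕ) :
    AcyclicResolution.extComplex N I ≅
      AcyclicResolution.extComplex (triv (Γ := Γ) k)
        (((ihomFunctor N).mapHomologicalComplex (ComplexShape.up ℕ)).obj I) :=
  HomologicalComplex.Hom.isoOfComponents
    (fun n => AddEquiv.toAddCommGrpIso (curryExt₀ N (I.X n)))
    (fun i j _ => by
      ext x
      change ((AcyclicResolution.extComplex (triv (Γ := Γ) k)
          (((ihomFunctor N).mapHomologicalComplex (ComplexShape.up ℕ)).obj I)).d i j).hom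
          (curryExt₀ N (I.X i) x) =
        curryExt₀ N (I.X j) (((AcyclicResolution.extComplex N I).d i j).hom x)
      rw [AcyclicResolution.extComplex_d_apply, AcyclicResolution.extComplex_d_apply,
        curryExt₀_comp_mk₀]
      rfl)

/-- Hence **`Hⁿ(Ext⁰(N, I•)) ≅ Hⁿ(Ext⁰(triv k, Hom(N, I•)))`**.
[cite: Harari2020, §16.2, Theorem 16.14, proof, (16.2) (p. 269)] -/
def extComplexCurryHomologyIso (I : CochainComplex (DiscreteRepCat k Γ) ℕ) (n : ℕ) :
    (AcyclicResolution.extComplex N I).homology n ≅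
      (AcyclicResolution.extComplex (triv (Γ := Γ) k)
        (((ihomFunctor N).mapHomologicalComplex (ComplexShape.up ℕ)).obj I)).homology n :=
  (HomologicalComplex.homologyFunctor _ _ n).mapIso (extComplexCurryIso N I)

end Curry

/-! ## §3 `Hom_k(N, CoInd V) ≅ CoInd(Hom_k(N, V))`; acyclicity of `Hom(N, CoInd V)` -/

section IhomCoind

variable (N : DiscreteRepCat k Γ) (V : Type u) [AddCommGroup V] [Module k V]

/-- The orbit map `x ↦ ρ(x) a` of a discrete representation is locally constant.
[cite: SerreGaloisCohomology1997, I §2.5] -/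
theorem isLocallyConstant_ρ_apply (a : N.obj.V) :
    IsLocallyConstant (fun x : Γ => N.obj.ρ x a) := by
  have h := (isLocallyConstant_ρ_inv_apply N a).comp_continuous continuous_inv
  simpa only [Function.comp_def, inv_inv] using h

/-- For `Φ : Γ → Hom_k(N, V)` locally constant and `a ∈ N`, `x ↦ Φ(x)(ρ(x⁻¹) a)` is locally constant.
[cite: SerreGaloisCohomology1997, I §2.5] -/
theorem isLocallyConstant_apply_ρ_inv (Φ : LocallyConstant Γ (N.obj.V →ₗ[k] V)) (a : N.obj.V) :
    IsLocallyConstant (fun x : Γ => Φ x (N.obj.ρ x⁻¹ a)) :=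
  (Φ.isLocallyConstant.prodMk (isLocallyConstant_ρ_inv_apply N a)).comp
    (fun p : (N.obj.V →ₗ[k] V) × N.obj.V => p.1 p.2)

/-- The forward map `CoInd(Hom_k(N, V)) → Hom_k(N, CoInd V)`, `Φ ↦ (a ↦ (x ↦ Φ(x)(ρ(x⁻¹) a)))`,
as a `k`-linear map. [cite: SerreGaloisCohomology1997, I §2.5][cite: MilneADT2006, I §0, Remark 0.11] -/
def ihomCoindFwd : LocallyConstant Γ (N.obj.V →ₗ[k] V) →ₗ[k] (N.obj.V →ₗ[k] LocallyConstant Γ V) where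
  toFun Φ :=
    { toFun := fun a => ⟨fun x => Φ x (N.obj.ρ x⁻¹ a), isLocallyConstant_apply_ρ_inv N V Φ a⟩
      map_add' := fun a b => LocallyConstant.ext fun x => by simp
      map_smul' := fun c a => LocallyConstant.ext fun x => by simp }
  map_add' _ _ := LinearMap.ext fun _ => LocallyConstant.ext fun _ => rfl
  map_smul' _ _ := LinearMap.ext fun _ => LocallyConstant.ext fun _ => rfl

/-- Formula for `ihomCoindFwd`. [cite: SerreGaloisCohomology1997, I §2.5] -/
@[simp]
theorem ihomCoindFwd_apply_apply (Φ : LocallyConstant Γ (N.obj.V →ₗ[k] V)) (a : N.obj.V) (x : Γ) :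
    ihomCoindFwd N V Φ a x = Φ x (N.obj.ρ x⁻¹ a) := rfl

variable [Module.Finite k N.obj.V]

/-- For `F : N → CoInd V` linear, `x ↦ (a ↦ F(ρ(x) a)(x))` is locally constant as a map to
`Hom_k(N, V)` (check on a finite generating family of `N`). [cite: SerreGaloisCohomology1997, I §2.5] -/
theorem isLocallyConstant_ihomCoindBwd (F : N.obj.V →ₗ[k] LocallyConstant Γ V) :
    IsLocallyConstant (fun x : Γ =>
      ({ toFun := fun a => F (N.obj.ρ x a) x
         map_add' := fun a b => by simp
         map_smul' := fun c a => by simp } : N.obj.V →ₗ[k] V)) := by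
  obtain ⟨n, s, hs⟩ := Module.Finite.exists_fin (R := k) (M := N.obj.V)
  refine (IsLocallyConstant.iff_eventually_eq _).2 fun x => ?_
  have h : ∀ i, ∀ᶠ y in 𝓝 x, F (N.obj.ρ y (s i)) y = F (N.obj.ρ x (s i)) x := fun i => by
    filter_upwards [(isLocallyConstant_ρ_apply N (s i)).eventually_eq x,
      (F (N.obj.ρ x (s i))).isLocallyConstant.eventually_eq x] with y hy hy'
    rw [hy]
    exact hy'
  filter_upwards [Filter.eventually_all.2 h] with y hy
  exact LinearMap.ext_on_range hs fun i => hy i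

/-- The backward map `Hom_k(N, CoInd V) → CoInd(Hom_k(N, V))`, `F ↦ (x ↦ (a ↦ F(ρ(x) a)(x)))`, as a
`k`-linear map. [cite: SerreGaloisCohomology1997, I §2.5][cite: MilneADT2006, I §0, Remark 0.11] -/
def ihomCoindBwd : (N.obj.V →ₗ[k] LocallyConstant Γ V) →ₗ[k] LocallyConstant Γ (N.obj.V →ₗ[k] V) where
  toFun F := ⟨_, isLocallyConstant_ihomCoindBwd N V F⟩
  map_add' _ _ := LocallyConstant.ext fun _ => LinearMap.ext fun _ => rfl
  map_smul' _ _ := LocallyConstant.ext fun _ => LinearMap.ext fun _ => rfl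

/-- Formula for `ihomCoindBwd`. [cite: SerreGaloisCohomology1997, I §2.5] -/
@[simp]
theorem ihomCoindBwd_apply_apply (F : N.obj.V →ₗ[k] LocallyConstant Γ V) (x : Γ) (a : N.obj.V) :
    ihomCoindBwd N V F x a = F (N.obj.ρ x a) x := rfl

variable [CompactSpace Γ]

/-- **`Hom_k(N, CoInd V) ≅ CoInd(Hom_k(N, V))` in `Rep k Γ`**: the forward map is
`Φ ↦ (a ↦ (x ↦ Φ(x)(ρ(x⁻¹) a)))`, equivariant for the conjugation action on the source-side `Hom` and
the translation actions `(g·h)(x) = h(g⁻¹x)` of the co-induced modules.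
[cite: SerreGaloisCohomology1997, I §2.5][cite: MilneADT2006, I §0, Remark 0.11] -/
def ihomCoindRepIso :
    (Rep.ihom N.obj).obj (coindRep k Γ V) ≅ coindRep k Γ (N.obj.V →ₗ[k] V) where
  hom := Rep.ofHom ⟨ihomCoindBwd N V, fun g => LinearMap.ext fun F =>
    LocallyConstant.ext fun x => LinearMap.ext fun a => by
      change ihomCoindBwd N V ((coindRep k Γ V).ρ g ∘ₗ F ∘ₗ N.obj.ρ g⁻¹) x a =
        coindRepr k Γ _ g (ihomCoindBwd N V F) x a
      rw [ihomCoindBwd_apply_apply, coindRepr_apply_apply, ihomCoindBwd_apply_apply,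
        LinearMap.comp_apply, LinearMap.comp_apply, ← Module.End.mul_apply, ← map_mul]
      change coindRepr k Γ V g (F (N.obj.ρ (g⁻¹ * x) a)) x = _
      rw [coindRepr_apply_apply]⟩
  inv := Rep.ofHom ⟨ihomCoindFwd N V, fun g => LinearMap.ext fun Φ =>
    LinearMap.ext fun a => LocallyConstant.ext fun x => by
      change ihomCoindFwd N V (coindRepr k Γ _ g Φ) a x =
        ((coindRep k Γ V).ρ g ∘ₗ ihomCoindFwd N V Φ ∘ₗ N.obj.ρ g⁻¹) a x
      rw [ihomCoindFwd_apply_apply, coindRepr_apply_apply, LinearMap.comp_apply,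
        LinearMap.comp_apply]
      change _ = coindRepr k Γ V g (ihomCoindFwd N V Φ (N.obj.ρ g⁻¹ a)) x
      rw [coindRepr_apply_apply, ihomCoindFwd_apply_apply, ← Module.End.mul_apply, ← map_mul,
        mul_inv_rev, inv_inv, mul_assoc, mul_inv_cancel, mul_one]⟩
  hom_inv_id := Rep.hom_ext (DFunLike.ext _ _ fun (F : N.obj.V →ₗ[k] LocallyConstant Γ V) =>
    LinearMap.ext fun a => LocallyConstant.ext fun x => by
      change ihomCoindFwd N V (ihomCoindBwd N V F) a x = F a x
      rw [ihomCoindFwd_apply_apply, ihomCoindBwd_apply_apply, ← Module.End.mul_apply, ← map_mul,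
        mul_inv_cancel, map_one, Module.End.one_apply])
  inv_hom_id := Rep.hom_ext (DFunLike.ext _ _ fun (Φ : LocallyConstant Γ (N.obj.V →ₗ[k] V)) =>
    LocallyConstant.ext fun x => LinearMap.ext fun a => by
      change ihomCoindBwd N V (ihomCoindFwd N V Φ) x a = Φ x a
      rw [ihomCoindBwd_apply_apply, ihomCoindFwd_apply_apply, ← Module.End.mul_apply, ← map_mul,
        inv_mul_cancel, map_one, Module.End.one_apply])

/-- **`Hom(N, CoInd V) ≅ CoInd(Hom_k(N, V))` in `C_Γ`.**
[cite: SerreGaloisCohomology1997, I §2.5][cite: MilneADT2006, I §0, Remark 0.11] -/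
def ihomCoindIso : ihomObj N (coind k Γ V) ≅ coind k Γ (N.obj.V →ₗ[k] V) :=
  (isDiscrete k Γ).isoMk (ihomCoindRepIso N V)

variable {V} in
/-- **`Hom(N, M)` is `Ext(k, –)`-acyclic whenever `M` is co-induced**:
`Ext^{q+1}_{C_Γ}(triv k, Hom(N, M)) = 0` for `M ≅ CoInd V`.
[cite: Harari2020, §16.2, Theorem 16.14, proof (p. 270)][cite: SerreGaloisCohomology1997, I §2.5] -/
theorem ext_triv_ihomObj_eq_zero_of_iso_coind {M : DiscreteRepCat k Γ} (e : M ≅ coind k Γ V) (q : ℕ)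
    (x : Ext (triv (Γ := Γ) k) (ihomObj N M) (q + 1)) : x = 0 :=
  ext_triv_eq_zero_of_iso_coind ((ihomFunctor N).mapIso e ≪≫ ihomCoindIso N V) q x

end IhomCoind

end DiscreteRep

end Literature.Algebra.Homology
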